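/-
Cell hodgecm-mathlib — seat A-p16 (g9), idle-hands generic leaf (director s86 (2)(c); A-plan1 g7 GS line card §GS-7 (7d)(β′),
A-plan2 A.13 ADDENDUM 2 lemma list L2 + L4).  THEOREMS ONLY; 0 def / 0 fact / 0 instance / 0 sorry.  HC_CM is NOT proved by this
file; HC_CM is proved only modulo the 7 printed citations until rung 0 closes.
-/
import Literature.AlgebraicGeometry.ShimuraVarieties.UnitaryShimuraCanonicalModelHecke
import Literature.NumberTheory.Automorphic.Liu2021.AppendixC.HeckeTranslates
import HarnessLib

/-!
# Hecke translates between conjugate levels are isomorphisms; small normal levels inside finitely many conjugates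

Bookkeeping for the record systems `S : RecordSystem L H τ T hT K₀` of Deligne's canonical model of the compact unitary Shimura
surface ([Milne2005ShimuraVarieties] §13 Thm. 13.6, the tree's `RecordSystem.IsHeckeTranslate`), needed when a cohomology class is
moved from an arbitrary connected component of `M_{K''}` to the identity component of a CONJUGATE level `L = bK''b⁻¹`
([Milne2005ShimuraVarieties] §5 p. 58 L6–11: `T(g) ∘ T(g⁻¹) = T(1) = id`):

* §1 (levels, any topological group; `C5` currency of [Liu2021] Prop. C.5): inside a sufficiently small level `K' ⊆ K₀` and for a
  FINITE family `g : ι → H` there is a sufficiently small level `K'' ⊆ K'`, NORMALISED by `K'`, with `g_q K'' g_q⁻¹ ⊆ K₀` for every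
  `q` (the normal core in the compact group `K'` of the open finite-index subgroup `K' ∩ ⋂_q g_q⁻¹K₀g_q`); consequently for
  `b = g_q k'`, `k' ∈ K'`, the conjugate `bK''b⁻¹` is again `⊆ K₀`, the conjugate level `C5.heckeLevel b K''` IS `bK''b⁻¹`, and the
  level conditions `b⁻¹(bK''b⁻¹)b ⊆ K''`, `b K'' b⁻¹ ⊆ bK''b⁻¹` for the two translates `T_b`, `T_{b⁻¹}` hold.
* §2 (record systems): translates `T_g : M_K ⟶ M_{K'}` and `T_h : M_{K'} ⟶ M_K` with `gh ∈ K` compose to the identity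
  (`isHeckeTranslate_comp` + `heckeTranslate_eq_id_of_mem`); hence `T_g` with an inverse-direction translate `T_{g⁻¹}` is an
  ISOMORPHISM of `L`-schemes `M_K ≅ M_{K'}`, and under `HeckeTranslateDefinedOver` the conjugate levels `M_{bK''b⁻¹} ≅ M_{K''}` are
  isomorphic through `T_b` / `T_{b⁻¹}`.

Design: no new definitions (the isomorphism is delivered as `IsIso`/`∃ e : _ ≅ _`); nothing about connected components / pieces
(that is the consumer's (7c) API).  Sources: [Milne2005ShimuraVarieties] §5 p. 57 L7–12, p. 58 L3–11, §13 p. 118 L21–28;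
[Liu2021] Prop. C.5 l. 4627–4632 (sufficiently small levels); [DDMSAnalyticProP1999] Prop. 1.2 (i) (open subgroups of a profinite
group contain open normal subgroups — used inside the compact `K'`; Mathlib device `Subgroup.normalCore` +
`Subgroup.finiteIndex_of_finite_quotient` + `Subgroup.isOpen_of_isClosed_of_finiteIndex`).  Cited, not restated: the tree's
`RecordSystem.IsHeckeTranslate` API (`UnitaryShimuraCanonicalModelHecke` §2) and `C5.HeckeLE`/`C5.heckeLevel`
(`Liu2021/AppendixC/HeckeTranslates` §1).
-/

set_option autoImplicit false

noncomputable section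

open Function Topology NumberField CategoryTheory Matrix
open scoped Matrix ComplexOrder Pointwise
open Literature.NumberTheory.Automorphic Literature.NumberTheory.Automorphic.UnitaryGroup
open Literature.NumberTheory.Automorphic.Liu2021.AppendixC (C5.OpenCompactSubgroup C5.SmallLevel C5.HeckeLE C5.heckeLevel)
open Literature.Geometry.ComplexHyperbolic Literature.Geometry.ComplexHyperbolic.BallModel

/-! ## §1. Levels: a small level normalised by `K'` inside finitely many conjugates of `K₀` -/

namespace Literature.NumberTheory.Automorphic.Liu2021.AppendixC.C5

variable {H : Type} [Group H] [TopologicalSpace H] [IsTopologicalGroup H] {K₀ : OpenCompactSubgroup H}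

/-- In a topological group, for an open subgroup `A` and a COMPACT open subgroup `K'` there is an open compact subgroup
`N ⊆ A ∩ K'` normalised by `K'` — the normal core of `A ∩ K'` in `K'` (finite index since `K'` is compact and `A` open;
stated in [DDMSAnalyticProP1999] Prop. 1.2 (i) for profinite groups «every open subgroup … has finite index in `G`, and contains an
open normal subgroup of `G`» — only the compactness of `K'` is used here). [cite: DDMSAnalyticProP1999, Prop. 1.2 (i)] -/
theorem exists_open_compact_subgroup_le_normalised (K' A : Subgroup H) (hK'o : IsOpen (K' : Set H))
    (hK'c : IsCompact (K' : Set H)) (hAo : IsOpen (A : Set H)) :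
    ∃ N : Subgroup H, IsOpen (N : Set H) ∧ IsCompact (N : Set H) ∧ N ≤ A ⊓ K' ∧
      ∀ k ∈ K', ∀ n ∈ N, k⁻¹ * n * k ∈ N := by
  haveI : CompactSpace K' := isCompact_iff_compactSpace.1 hK'c
  -- the trace of `A` on the compact group `K'`, an open subgroup of finite index
  let A' : Subgroup K' := A.subgroupOf K'
  have hA'o : IsOpen (A' : Set K') := hAo.preimage continuous_subtype_val
  haveI : A'.FiniteIndex := by
    haveI : DiscreteTopology (K' ⧸ A') := QuotientGroup.discreteTopology hA'o
    haveI : Finite (K' ⧸ A') := finite_of_compact_of_discrete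
    exact Subgroup.finiteIndex_of_finite_quotient
  have hNo : IsOpen (A'.normalCore : Set K') :=
    Subgroup.isOpen_of_isClosed_of_finiteIndex _ (A'.normalCore_isClosed (A'.isClosed_of_isOpen hA'o))
  refine ⟨A'.normalCore.map K'.subtype, ?_, ?_, ?_, ?_⟩
  · rw [Subgroup.coe_map]
    exact hK'o.isOpenMap_subtype_val _ hNo
  · rw [Subgroup.coe_map]
    exact (A'.normalCore.isClosed_of_isOpen hNo).isCompact.image continuous_subtype_val
  · refine (Subgroup.map_mono A'.normalCore_le).trans ?_
    rw [Subgroup.subgroupOf_map_subtype]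
  · rintro k hk _ ⟨x, hx, rfl⟩
    refine ⟨⟨k, hk⟩⁻¹ * x * ⟨k, hk⟩, ?_, ?_⟩
    · have h := A'.normalCore_normal.conj_mem x hx ⟨k, hk⟩⁻¹
      rw [inv_inv] at h
      exact h
    · simp only [Subgroup.coe_subtype, Subgroup.coe_mul, InvMemClass.coe_inv]

/-- **Small normalised level inside finitely many conjugates** ([Liu2021] Prop. C.5 «sufficiently small»; [Milne2005ShimuraVarieties]
§5 p. 58): for a sufficiently small level `K' ⊆ K₀` and a finite family `g : ι → H` there is a sufficiently small level
`K'' ⊆ K'`, normalised by `K'` (the normaliser clause in the textual form of `RecordSystem.IsLevelQuotient`), with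
`g_q K'' g_q⁻¹ ⊆ K₀` for all `q` (so every conjugate `g_q k' K'' (g_q k')⁻¹`, `k' ∈ K'`, is again a level below the threshold `K₀`):
[DDMSAnalyticProP1999] Prop. 1.2 (i) inside the compact open `K'`, applied to the open subgroup `K' ∩ ⋂_q g_q⁻¹K₀g_q`.
[cite: DDMSAnalyticProP1999, Prop. 1.2 (i)] [cite: Liu2021, Prop. C.5 l. 4627–4628] -/
theorem exists_smallLevel_le_normalised_conj_le (K' : SmallLevel K₀) {ι : Type} [Finite ι] (g : ι → H) :
    ∃ K'' : SmallLevel K₀, K'' ≤ K' ∧ (∀ k ∈ K'.1.1, ∀ n ∈ K''.1.1, k⁻¹ * n * k ∈ K''.1.1) ∧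
      ∀ q, ∀ n ∈ K''.1.1, g q * n * (g q)⁻¹ ∈ K₀.1 := by
  -- `A := K' ∩ ⋂_q g_q⁻¹ K₀ g_q`, an open subgroup of `K'`
  let A : Subgroup H := K'.1.1 ⊓ ⨅ q, K₀.1.map (MulAut.conj (g q)⁻¹).toMonoidHom
  have hconj_open : ∀ q, IsOpen ((K₀.1.map (MulAut.conj (g q)⁻¹).toMonoidHom : Subgroup H) : Set H) := fun q => by
    have himg : ((K₀.1.map (MulAut.conj (g q)⁻¹).toMonoidHom : Subgroup H) : Set H) =
        (fun x : H => (g q)⁻¹ * x * (g q)⁻¹⁻¹) '' (K₀.1 : Set H) := by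
      rw [Subgroup.coe_map]; rfl
    rw [himg, ← Set.image_image (fun x : H => x * (g q)⁻¹⁻¹) (fun x : H => (g q)⁻¹ * x)]
    exact (isOpenMap_mul_right _) _ ((isOpenMap_mul_left _) _ K₀.2.1)
  have hAo : IsOpen (A : Set H) := by
    have : (A : Set H) = (K'.1.1 : Set H) ∩ ⋂ q, ((K₀.1.map (MulAut.conj (g q)⁻¹).toMonoidHom : Subgroup H) : Set H) := by
      simp only [A, Subgroup.coe_inf, Subgroup.coe_iInf]
    rw [this]
    exact K'.1.2.1.inter (isOpen_iInter_of_finite hconj_open)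
  obtain ⟨N, hNo, hNc, hNAK', hNn⟩ :=
    exists_open_compact_subgroup_le_normalised K'.1.1 A K'.1.2.1 K'.1.2.2 hAo
  have hNA : N ≤ A := hNAK'.trans inf_le_left
  have hNK' : N ≤ K'.1.1 := hNAK'.trans inf_le_right
  refine ⟨⟨⟨N, hNo, hNc⟩, hNK'.trans K'.2⟩, hNK', hNn, fun q x hx => ?_⟩
  have hx' : x ∈ (K₀.1.map (MulAut.conj (g q)⁻¹).toMonoidHom : Subgroup H) :=
    (Subgroup.mem_iInf.1 (Subgroup.mem_inf.1 (hNA hx)).2) q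
  obtain ⟨y, hy, hyx⟩ := Subgroup.mem_map.1 hx'
  rw [MulEquiv.coe_toMonoidHom, MulAut.conj_apply] at hyx
  subst hyx
  have e : g q * ((g q)⁻¹ * y * (g q)⁻¹⁻¹) * (g q)⁻¹ = y := by group
  rw [e]
  exact hy

omit [IsTopologicalGroup H] in
/-- For `b = g k'` with `k' ∈ K'` normalising `K''` and `g K'' g⁻¹ ⊆ K₀`: `b K'' b⁻¹ ⊆ K₀` ([Milne2005ShimuraVarieties] §5 p. 58
L6–11, bookkeeping of the conjugate levels `gKg⁻¹`). [cite: Milne2005ShimuraVarieties, §5 p. 58 L6–11] -/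
theorem conj_mem_of_normalised {K' K'' : SmallLevel K₀} {g k' : H} (hk' : k' ∈ K'.1.1)
    (hn : ∀ k ∈ K'.1.1, ∀ n ∈ K''.1.1, k⁻¹ * n * k ∈ K''.1.1) (hg : ∀ n ∈ K''.1.1, g * n * g⁻¹ ∈ K₀.1) :
    ∀ n ∈ K''.1.1, (g * k') * n * (g * k')⁻¹ ∈ K₀.1 := fun n hn' => by
  have e : (g * k') * n * (g * k')⁻¹ = g * (k'⁻¹⁻¹ * n * k'⁻¹) * g⁻¹ := by group
  rw [e]
  exact hg _ (hn k'⁻¹ (K'.1.1.inv_mem hk') n hn')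

/-- If `b K b⁻¹ ⊆ K₀` then the conjugate level `heckeLevel b K = bKb⁻¹ ∩ K₀` IS `bKb⁻¹` ([Milne2005ShimuraVarieties] §13 p. 118
L21–26). [cite: Milne2005ShimuraVarieties, §13 p. 118 L21–26] -/
theorem heckeLevel_val_eq_map_of_conj_mem {K : SmallLevel K₀} {b : H} (hb : ∀ x ∈ K.1.1, b * x * b⁻¹ ∈ K₀.1) :
    ((heckeLevel b K).1.1 : Subgroup H) = K.1.1.map (MulAut.conj b).toMonoidHom := by
  rw [heckeLevel_val]
  refine inf_eq_left.2 fun x hx => ?_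
  obtain ⟨y, hy, rfl⟩ := Subgroup.mem_map.1 hx
  rw [MulEquiv.coe_toMonoidHom, MulAut.conj_apply]
  exact hb y hy

/-- If `b K b⁻¹ ⊆ K₀`, membership in the conjugate level: `x ∈ heckeLevel b K ↔ b⁻¹ x b ∈ K` ([Milne2005ShimuraVarieties] §13
p. 118 L21–26). [cite: Milne2005ShimuraVarieties, §13 p. 118 L21–26] -/
theorem mem_heckeLevel_iff_of_conj_mem {K : SmallLevel K₀} {b : H} (hb : ∀ x ∈ K.1.1, b * x * b⁻¹ ∈ K₀.1) (x : H) :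
    x ∈ (heckeLevel b K).1.1 ↔ b⁻¹ * x * b ∈ K.1.1 := by
  rw [heckeLevel_val_eq_map_of_conj_mem hb, Subgroup.mem_map]
  constructor
  · rintro ⟨y, hy, rfl⟩
    rw [MulEquiv.coe_toMonoidHom, MulAut.conj_apply]
    have e : b⁻¹ * (b * y * b⁻¹) * b = y := by group
    rwa [e]
  · intro h
    refine ⟨b⁻¹ * x * b, h, ?_⟩
    rw [MulEquiv.coe_toMonoidHom, MulAut.conj_apply]
    group

/-- The INVERSE level condition `(b⁻¹)⁻¹ K b⁻¹ = b K b⁻¹ ⊆ heckeLevel b K` holds as soon as `b K b⁻¹ ⊆ K₀` — so `T_{b⁻¹} : M_K ⟶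
M_{bKb⁻¹}` is an admissible translate, the inverse of `T_b : M_{bKb⁻¹} ⟶ M_K` (`heckeLE_heckeLevel`). [cite: Milne2005ShimuraVarieties, §5 p. 58 L6–11 and §13 p. 118 L21–26] -/
theorem heckeLE_inv_heckeLevel_of_conj_mem {K : SmallLevel K₀} {b : H} (hb : ∀ x ∈ K.1.1, b * x * b⁻¹ ∈ K₀.1) :
    HeckeLE b⁻¹ K (heckeLevel b K) := fun k hk => by
  rw [mem_heckeLevel_iff_of_conj_mem hb]
  have e : b⁻¹ * (b⁻¹⁻¹ * k * b⁻¹) * b = k := by group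
  rwa [e]

end Literature.NumberTheory.Automorphic.Liu2021.AppendixC.C5

/-! ## §2. Record systems: translates in opposite directions are mutually inverse -/

namespace Literature.AlgebraicGeometry.ShimuraVarieties.UnitaryCanonicalModel

open Literature.NumberTheory.Automorphic.Liu2021.AppendixC

variable {L : Type} [Field L] [NumberField L] [IsCMField L] {H : Matrix (Fin 3) (Fin 3) L}
  {τ : L →+* ℂ} {T : GL (Fin 3) ℂ} {hT : formCongr (starRingEnd ℂ) T (H.map τ) = BallModel.J}
  {K₀ : C5.OpenCompactSubgroup ↥(finAdelic (↥(maximalRealSubfield L)) L (IsCMField.complexConj L) 3 H)}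

/-- **`T_g ≫ T_h = 𝟙` when `gh ∈ K`**: a translate `T_g : M_K ⟶ M_{K'}` followed by a translate `T_h : M_{K'} ⟶ M_K` acts as
`T_{gh}` (`isHeckeTranslate_comp`), which is the identity for `gh ∈ K` (`heckeTranslate_eq_id_of_mem`).
[cite: Milne2005ShimuraVarieties, §5 p. 57 L7–12, p. 58 L6–11 and Thm. 13.6 p. 118] -/
theorem RecordSystem.heckeTranslate_comp_eq_id_of_mul_mem (S : RecordSystem L H τ T hT K₀) {K K' : C5.SmallLevel K₀}
    {g h : finAdelic (↥(maximalRealSubfield L)) L (IsCMField.complexConj L) 3 H}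
    {Tg : S.M.obj K ⟶ S.M.obj K'} {Th : S.M.obj K' ⟶ S.M.obj K}
    (hg : S.IsHeckeTranslate K K' g Tg) (hh : S.IsHeckeTranslate K' K h Th) (hgh : g * h ∈ K.1.1) :
    Tg ≫ Th = 𝟙 (S.M.obj K) :=
  S.heckeTranslate_eq_id_of_mem hgh (S.isHeckeTranslate_comp hg hh)

/-- **`T_g ≫ T_{g⁻¹} = 𝟙`**. [cite: Milne2005ShimuraVarieties, §5 p. 58 L6–11 and Thm. 13.6 p. 118] -/
theorem RecordSystem.heckeTranslate_comp_inv_eq_id (S : RecordSystem L H τ T hT K₀) {K K' : C5.SmallLevel K₀}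
    {g : finAdelic (↥(maximalRealSubfield L)) L (IsCMField.complexConj L) 3 H}
    {Tg : S.M.obj K ⟶ S.M.obj K'} {Tg' : S.M.obj K' ⟶ S.M.obj K}
    (hg : S.IsHeckeTranslate K K' g Tg) (hg' : S.IsHeckeTranslate K' K g⁻¹ Tg') :
    Tg ≫ Tg' = 𝟙 (S.M.obj K) :=
  S.heckeTranslate_comp_eq_id_of_mul_mem hg hg' (by rw [mul_inv_cancel]; exact K.1.1.one_mem)

/-- **`T_{g⁻¹} ≫ T_g = 𝟙`**. [cite: Milne2005ShimuraVarieties, §5 p. 58 L6–11 and Thm. 13.6 p. 118] -/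
theorem RecordSystem.heckeTranslate_inv_comp_eq_id (S : RecordSystem L H τ T hT K₀) {K K' : C5.SmallLevel K₀}
    {g : finAdelic (↥(maximalRealSubfield L)) L (IsCMField.complexConj L) 3 H}
    {Tg : S.M.obj K ⟶ S.M.obj K'} {Tg' : S.M.obj K' ⟶ S.M.obj K}
    (hg : S.IsHeckeTranslate K K' g Tg) (hg' : S.IsHeckeTranslate K' K g⁻¹ Tg') :
    Tg' ≫ Tg = 𝟙 (S.M.obj K') :=
  S.heckeTranslate_comp_eq_id_of_mul_mem hg' hg (by rw [inv_mul_cancel]; exact K'.1.1.one_mem)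

/-- **A Hecke translate with an opposite translate is an isomorphism of the models** `M_K ≅ M_{K'}` over `L`
(`T(g)T(g⁻¹) = T(1) = id`, [Milne2005ShimuraVarieties] §5 p. 58 L6–11; for the canonical model Thm. 13.6 p. 118).
[cite: Milne2005ShimuraVarieties, §5 p. 58 L6–11 and Thm. 13.6 p. 118] -/
theorem RecordSystem.isIso_of_isHeckeTranslate (S : RecordSystem L H τ T hT K₀) {K K' : C5.SmallLevel K₀}
    {g h : finAdelic (↥(maximalRealSubfield L)) L (IsCMField.complexConj L) 3 H}
    {Tg : S.M.obj K ⟶ S.M.obj K'} {Th : S.M.obj K' ⟶ S.M.obj K}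
    (hg : S.IsHeckeTranslate K K' g Tg) (hh : S.IsHeckeTranslate K' K h Th) (hgh : g * h ∈ K.1.1) (hhg : h * g ∈ K'.1.1) :
    IsIso Tg :=
  ⟨⟨Th, S.heckeTranslate_comp_eq_id_of_mul_mem hg hh hgh, S.heckeTranslate_comp_eq_id_of_mul_mem hh hg hhg⟩⟩

/-- `T_g` is an isomorphism as soon as a translate `T_{g⁻¹}` in the opposite direction exists.
[cite: Milne2005ShimuraVarieties, §5 p. 58 L6–11 and Thm. 13.6 p. 118] -/
theorem RecordSystem.isIso_of_isHeckeTranslate_inv (S : RecordSystem L H τ T hT K₀) {K K' : C5.SmallLevel K₀}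
    {g : finAdelic (↥(maximalRealSubfield L)) L (IsCMField.complexConj L) 3 H}
    {Tg : S.M.obj K ⟶ S.M.obj K'} {Tg' : S.M.obj K' ⟶ S.M.obj K}
    (hg : S.IsHeckeTranslate K K' g Tg) (hg' : S.IsHeckeTranslate K' K g⁻¹ Tg') : IsIso Tg :=
  ⟨⟨Tg', S.heckeTranslate_comp_inv_eq_id hg hg', S.heckeTranslate_inv_comp_eq_id hg hg'⟩⟩

/-- The inverse of the isomorphism `T_g` IS the opposite translate `T_{g⁻¹}` (uniqueness of inverses).
[cite: Milne2005ShimuraVarieties, §5 p. 58 L6–11 and Thm. 13.6 p. 118] -/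
theorem RecordSystem.inv_eq_of_isHeckeTranslate_inv (S : RecordSystem L H τ T hT K₀) {K K' : C5.SmallLevel K₀}
    {g : finAdelic (↥(maximalRealSubfield L)) L (IsCMField.complexConj L) 3 H}
    {Tg : S.M.obj K ⟶ S.M.obj K'} {Tg' : S.M.obj K' ⟶ S.M.obj K}
    (hg : S.IsHeckeTranslate K K' g Tg) (hg' : S.IsHeckeTranslate K' K g⁻¹ Tg') :
    letI := S.isIso_of_isHeckeTranslate_inv hg hg'
    inv Tg = Tg' := by
  letI := S.isIso_of_isHeckeTranslate_inv hg hg'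
  exact IsIso.inv_eq_of_hom_inv_id (S.heckeTranslate_comp_inv_eq_id hg hg')

/-- **Opposite levels are isomorphic through the translates** (∃-form): if `g⁻¹Kg ⊆ K'` and `gK'g⁻¹ ⊆ K` and the record system
has its Hecke translates defined over `L` ([Milne2005ShimuraVarieties] Thm. 13.6), there is an isomorphism `e : M_K ≅ M_{K'}` of
`L`-schemes with `e.hom = T_g` and `e.inv = T_{g⁻¹}` on complex points. [cite: Milne2005ShimuraVarieties, Thm. 13.6 p. 118 and §5 p. 58 L6–11] -/
theorem RecordSystem.exists_iso_isHeckeTranslate (S : RecordSystem L H τ T hT K₀) (hS : S.HeckeTranslateDefinedOver)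
    (g : finAdelic (↥(maximalRealSubfield L)) L (IsCMField.complexConj L) 3 H) (K K' : C5.SmallLevel K₀)
    (hK : C5.HeckeLE g K K') (hK' : C5.HeckeLE g⁻¹ K' K) :
    ∃ e : S.M.obj K ≅ S.M.obj K', S.IsHeckeTranslate K K' g e.hom ∧ S.IsHeckeTranslate K' K g⁻¹ e.inv := by
  obtain ⟨Tg, hg⟩ := hS g K K' hK
  obtain ⟨Tg', hg'⟩ := hS g⁻¹ K' K hK'
  exact ⟨⟨Tg, Tg', S.heckeTranslate_comp_inv_eq_id hg hg', S.heckeTranslate_inv_comp_eq_id hg hg'⟩, hg, hg'⟩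

/-- **The conjugate level is isomorphic to the level**: for `b` with `bKb⁻¹ ⊆ K₀` the models at `heckeLevel b K = bKb⁻¹` and at `K`
are isomorphic through `T_b : M_{bKb⁻¹} ⟶ M_K` and `T_{b⁻¹} : M_K ⟶ M_{bKb⁻¹}` — the move of [Milne2005ShimuraVarieties] §5
p. 58 («`T(g)` is an isomorphism `Sh_{gKg⁻¹} → Sh_K`», L6–11) for the canonical model (Thm. 13.6 p. 118).
[cite: Milne2005ShimuraVarieties, §5 p. 58 L6–11 and Thm. 13.6 p. 118] -/
theorem RecordSystem.exists_iso_heckeLevel (S : RecordSystem L H τ T hT K₀) (hS : S.HeckeTranslateDefinedOver)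
    (K : C5.SmallLevel K₀) (b : finAdelic (↥(maximalRealSubfield L)) L (IsCMField.complexConj L) 3 H)
    (hb : ∀ x ∈ K.1.1, b * x * b⁻¹ ∈ K₀.1) :
    ∃ e : S.M.obj (C5.heckeLevel b K) ≅ S.M.obj K,
      S.IsHeckeTranslate (C5.heckeLevel b K) K b e.hom ∧ S.IsHeckeTranslate K (C5.heckeLevel b K) b⁻¹ e.inv :=
  S.exists_iso_isHeckeTranslate hS b (C5.heckeLevel b K) K (C5.heckeLE_heckeLevel b K)
    (C5.heckeLE_inv_heckeLevel_of_conj_mem hb)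

end Literature.AlgebraicGeometry.ShimuraVarieties.UnitaryCanonicalModel

end
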